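import Mathlib
import HarnessLib
import Literature.Analysis.ValidatedNumerics.IntervalLogArctan
import Summits.KontsevichZagierPeriods.Zeta5Search.Denom.TwoTaleP15LineCertificate
import Summits.KontsevichZagierPeriods.Zeta5Search.Denom.RungALineProfileShape

/-!
# Two-point tangent certificate for the rung-A line profile (rung-A decay, one-variable side)

HONEST FRAMING: systematic search; no irrationality claim unless certified.  This file proves an
inequality about an explicit elementary function of one real variable; no statement about
`ζ(2)`, `ζ(5)` or any linear form is made here.

With `PA = profileA (23/10)` and `DA = angleA (23/10) − 2π` (`Denom/RungALineProfileShape.lean`),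
the two-point lemma `RungALineProfileShape.twoPoint` reduces `sup_{η>0} PA ≤ c` to three facts at
two rational points.  They are certified at `η₁ = 4631/5000 = 0.9262`, `η₂ = 4632/5000 = 0.9264`
by the tree's kernel interval engine `Literature.Analysis.ValidatedNumerics` exactly as in the
P15 file `Denom/TwoTaleP15LineCertificate.lean` (whose scale `sc = 2^56`, term counts `KL`, `KA`
and `mem_zero` are reused): evaluators `legA10`/`legG10`/`sumA10`/`sumG10`/`constGA` for legs
`p/10`, the Boolean test `certCheckA` (`certCheckA_eq : certCheckA = true` by `decide +kernel`)
and its soundness `certCheckA_sound`, giving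

* `profileA_le : η ≠ 0 → profileA (23/10) η ≤ −13.22912` (design supremum `−13.22912419…`,
  attained near `η = 0.92631`; two-point bound `−13.2291241…`), and the certificate WITH SLACK
* `certA_delta : 0 ≤ δ → δ ≤ 4 → η ≠ 0 → profileA0 (23/10) η − (2π − δ)|η| ≤ −13.22912 + 6 δ`
  (concavity on `(0, 6]` and the tail slope `PA_tail`),

the one-variable input of the rung-A decay `DecayA c`, `c < 13.22912` (fam-measure's line-integral
reduction at rung A, cell record `families/measure/FAMILY.md` §10).  Nothing here is conjectural.
-/

noncomputable section

open Real Set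

namespace Summit.KontsevichZagierPeriods.Zeta5Search.Denom.RungALineCertificate

open Summit.KontsevichZagierPeriods.Zeta5Search.Denom.LineProfile
open Summit.KontsevichZagierPeriods.Zeta5Search.Denom.RungALineProfileShape
open Summit.KontsevichZagierPeriods.Zeta5Search.Denom.TwoTaleP15LineCertificate
  (sc sc_pos KL KA mem_zero)
open Literature.Analysis.ValidatedNumerics.NumericsMP

/-- Enclosure of the angle `arctan ((p/10)/η)`, given `E ∋ η` and `piI ∋ π`. -/
def legA10 (piI E : MI) (p : ℤ) : Option MI :=
  match MI.divPos sc (MI.ofFrac sc p 10) E with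
  | some Q => MI.arctan sc KA piI Q
  | none => none

/-- Soundness of `legA10`. -/
theorem mem_legA10 {η : ℝ} {piI E : MI} (hpi : MI.mem sc Real.pi piI) (hE : MI.mem sc η E)
    {p : ℤ} {A : MI} (h : legA10 piI E p = some A) :
    MI.mem sc (Real.arctan ((p : ℝ) / 10 / η)) A := by
  unfold legA10 at h
  split at h
  · rename_i Q hQ
    have hW : MI.mem sc ((p : ℝ) / 10) (MI.ofFrac sc p 10) := by
      simpa using MI.mem_ofFrac sc p (by norm_num : 0 < 10)
    exact MI.mem_arctan sc_pos hpi h (MI.mem_divPos sc_pos hQ hW hE)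
  · simp at h

/-- Enclosure of `gPrim η (p/10)`, given `E ∋ η` and `piI ∋ π`. -/
def legG10 (piI E : MI) (p : ℤ) : Option MI :=
  match MI.logPos sc KL (((MI.ofFrac sc p 10).sqr sc).add (E.sqr sc)), legA10 piI E p with
  | some L, some A =>
    some (((((MI.ofFrac sc p 10).mul sc L).divNat 2).sub (MI.ofFrac sc p 10)).add (E.mul sc A))
  | _, _ => none

/-- Soundness of `legG10`. -/
theorem mem_legG10 {η : ℝ} {piI E : MI} (hpi : MI.mem sc Real.pi piI) (hE : MI.mem sc η E)
    {p : ℤ} {G : MI} (h : legG10 piI E p = some G) :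
    MI.mem sc (gPrim η ((p : ℝ) / 10)) G := by
  unfold legG10 at h
  split at h
  · rename_i L A hL hA
    simp only [Option.some.injEq] at h
    subst h
    have hW : MI.mem sc ((p : ℝ) / 10) (MI.ofFrac sc p 10) := by
      simpa using MI.mem_ofFrac sc p (by norm_num : 0 < 10)
    have hsum := MI.mem_add (MI.mem_sqr sc_pos hW) (MI.mem_sqr sc_pos hE)
    have hlog := (MI.mem_logPos sc_pos hL hsum).2
    have hA' := mem_legA10 hpi hE hA
    have key := MI.mem_add (MI.mem_sub (MI.mem_divNat (MI.mem_mul sc_pos hW hlog)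
      (by norm_num : 0 < 2)) hW) (MI.mem_mul sc_pos hE hA')
    have e : (p : ℝ) / 10 * Real.log (((p : ℝ) / 10) ^ 2 + η ^ 2) / ((2 : ℕ) : ℝ) - (p : ℝ) / 10
        + η * Real.arctan ((p : ℝ) / 10 / η) = gPrim η ((p : ℝ) / 10) := by
      simp only [gPrim]
      push_cast
      ring
    rw [e] at key
    exact key
  · simp at h

/-- The eight legs `(p, sign)` of the rung-A profile at `ξ = 23/10` (abscissae `p/10`). -/
def legsA : List (ℤ × ℤ) :=
  [(33, 1), (27, 1), (23, 1), (17, 1), (13, 1), (7, 1), (93, -1), (43, 1)]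

/-- Signed sum of the angle enclosures over a list of legs. -/
def sumA10 (piI E : MI) : List (ℤ × ℤ) → Option MI
  | [] => some ⟨0, 0⟩
  | (p, s) :: l =>
    match legA10 piI E p, sumA10 piI E l with
    | some A, some T => some (T.add (A.mulInt s))
    | _, _ => none

/-- Signed sum of the `gPrim` enclosures over a list of legs. -/
def sumG10 (piI E : MI) : List (ℤ × ℤ) → Option MI
  | [] => some ⟨0, 0⟩
  | (p, s) :: l =>
    match legG10 piI E p, sumG10 piI E l with
    | some G, some T => some (T.add (G.mulInt s))
    | _, _ => none

/-- The real signed angle sum over a list of legs (abscissae `p/10`). -/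
def realA10 (η : ℝ) : List (ℤ × ℤ) → ℝ
  | [] => 0
  | (p, s) :: l => realA10 η l + Real.arctan ((p : ℝ) / 10 / η) * s

/-- The real signed `gPrim` sum over a list of legs (abscissae `p/10`). -/
def realG10 (η : ℝ) : List (ℤ × ℤ) → ℝ
  | [] => 0
  | (p, s) :: l => realG10 η l + gPrim η ((p : ℝ) / 10) * s

/-- Soundness of `sumA10`. -/
theorem mem_sumA10 {η : ℝ} {piI E : MI} (hpi : MI.mem sc Real.pi piI) (hE : MI.mem sc η E) :
    ∀ (l : List (ℤ × ℤ)) {T : MI}, sumA10 piI E l = some T → MI.mem sc (realA10 η l) T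
  | [], T, h => by
    simp only [sumA10, Option.some.injEq] at h
    subst h
    exact mem_zero
  | (p, s) :: l, T, h => by
    simp only [sumA10] at h
    split at h
    · rename_i A T' hA hT'
      simp only [Option.some.injEq] at h
      subst h
      exact MI.mem_add (mem_sumA10 hpi hE l hT') (MI.mem_mulInt (mem_legA10 hpi hE hA) s)
    · simp at h

/-- Soundness of `sumG10`. -/
theorem mem_sumG10 {η : ℝ} {piI E : MI} (hpi : MI.mem sc Real.pi piI) (hE : MI.mem sc η E) :
    ∀ (l : List (ℤ × ℤ)) {T : MI}, sumG10 piI E l = some T → MI.mem sc (realG10 η l) T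
  | [], T, h => by
    simp only [sumG10, Option.some.injEq] at h
    subst h
    exact mem_zero
  | (p, s) :: l, T, h => by
    simp only [sumG10] at h
    split at h
    · rename_i G T' hG hT'
      simp only [Option.some.injEq] at h
      subst h
      exact MI.mem_add (mem_sumG10 hpi hE l hT') (MI.mem_mulInt (mem_legG10 hpi hE hG) s)
    · simp at h

/-- `realA10 η legsA = angleA (23/10) η = DA η + 2π`. -/
theorem realA10_legs (η : ℝ) : realA10 η legsA = DA η + 2 * Real.pi := by
  rw [DA_eq]
  simp only [realA10, legsA, numLegsA, denAngleA]
  push_cast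
  ring

/-- `realG10 η legsA + profileAConst − 2π|η| = PA η`. -/
theorem realG10_legs (η : ℝ) :
    realG10 η legsA + profileAConst - 2 * Real.pi * |η| = PA η := by
  rw [PA_eq]
  simp only [realG10, legsA]
  push_cast
  ring

/-- Enclosure of `profileAConst = 5 log 5 − 6 log 6 − 4 log 4 − 2 log 2 + 7`. -/
def constGA : Option MI :=
  match MI.logNat2 sc KL 5, MI.logNat2 sc KL 6, MI.logNat2 sc KL 4, MI.logNat2 sc KL 2 with
  | some A, some B, some C, some D =>
    some (((((A.mulInt 5).sub (B.mulInt 6)).sub (C.mulInt 4)).sub (D.mulInt 2)).add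
      (MI.ofInt sc 7))
  | _, _, _, _ => none

/-- Soundness of `constGA`. -/
theorem mem_constGA {C : MI} (h : constGA = some C) : MI.mem sc profileAConst C := by
  unfold constGA at h
  split at h
  · rename_i A B C' D hA hB hC hD
    simp only [Option.some.injEq] at h
    subst h
    have key := MI.mem_add (MI.mem_sub (MI.mem_sub (MI.mem_sub
      (MI.mem_mulInt (MI.mem_logNat2 sc_pos hA) 5) (MI.mem_mulInt (MI.mem_logNat2 sc_pos hB) 6))
      (MI.mem_mulInt (MI.mem_logNat2 sc_pos hC) 4)) (MI.mem_mulInt (MI.mem_logNat2 sc_pos hD) 2))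
      (MI.mem_ofInt sc 7)
    have e : Real.log ((5 : ℕ) : ℝ) * ((5 : ℤ) : ℝ) - Real.log ((6 : ℕ) : ℝ) * ((6 : ℤ) : ℝ)
        - Real.log ((4 : ℕ) : ℝ) * ((4 : ℤ) : ℝ) - Real.log ((2 : ℕ) : ℝ) * ((2 : ℤ) : ℝ)
        + ((7 : ℤ) : ℝ) = profileAConst := by
      simp only [profileAConst]
      push_cast
      ring
    rw [e] at key
    exact key
  · simp at h

/-- `η₁ = 4631/5000 = 0.9262`. -/
def etaOneA : MI := MI.ofFrac sc 4631 5000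

/-- `η₂ = 4632/5000 = 0.9264`. -/
def etaTwoA : MI := MI.ofFrac sc 4632 5000

/-- The kernel test: `DA η₁ ≥ 0`, `DA η₂ ≤ 0`, and
`PA η₁ + DA η₁ (η₂ − η₁) ≤ −13.22912`, as integer inequalities between enclosure ends. -/
def certCheckA : Bool :=
  match MI.pi sc KA with
  | some piI =>
    match sumA10 piI etaOneA legsA, sumA10 piI etaTwoA legsA, sumG10 piI etaOneA legsA,
      constGA with
    | some A1, some A2, some G1, some C =>
      decide (2 * piI.hi ≤ A1.lo) && (decide (A2.hi ≤ 2 * piI.lo) &&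
        decide (10 ^ 5 * (5000 * (G1.hi + C.hi) - 9262 * piI.lo + (A1.hi - 2 * piI.lo))
          ≤ -(1322912 * 5000 * (sc : ℤ))))
    | _, _, _, _ => false
  | none => false

/-- The kernel test passes (kernel evaluation of the interval engine). -/
theorem certCheckA_eq : certCheckA = true := by
  decide +kernel

/-- Soundness of the kernel test. -/
theorem certCheckA_sound (h : certCheckA = true) :
    0 ≤ DA (4631 / 5000) ∧ DA (4632 / 5000) ≤ 0 ∧
      PA (4631 / 5000) + DA (4631 / 5000) * (4632 / 5000 - 4631 / 5000) ≤ -13.22912 := by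
  unfold certCheckA at h
  split at h
  · rename_i piI hpiI
    split at h
    · rename_i A1 A2 G1 C hA1 hA2 hG1 hC
      simp only [Bool.and_eq_true, decide_eq_true_eq] at h
      obtain ⟨i1, i2, i3⟩ := h
      have hS : (0 : ℝ) < sc := by exact_mod_cast sc_pos
      have hpi := MI.mem_pi sc hpiI
      have hE1 : MI.mem sc (4631 / 5000 : ℝ) etaOneA := by
        simpa [etaOneA] using MI.mem_ofFrac sc 4631 (by norm_num : 0 < 5000)
      have hE2 : MI.mem sc (4632 / 5000 : ℝ) etaTwoA := by
        simpa [etaTwoA] using MI.mem_ofFrac sc 4632 (by norm_num : 0 < 5000)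
      have mA1 := mem_sumA10 hpi hE1 legsA hA1
      have mA2 := mem_sumA10 hpi hE2 legsA hA2
      have mG1 := mem_sumG10 hpi hE1 legsA hG1
      have mC := mem_constGA hC
      rw [realA10_legs] at mA1 mA2
      have c1 : (2 : ℝ) * piI.hi ≤ A1.lo := by exact_mod_cast i1
      have c2 : (A2.hi : ℝ) ≤ 2 * piI.lo := by exact_mod_cast i2
      have c3 : (10 : ℝ) ^ 5 * (5000 * ((G1.hi : ℝ) + C.hi) - 9262 * piI.lo
          + (A1.hi - 2 * piI.lo)) ≤ -(1322912 * 5000 * (sc : ℝ)) := by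
        exact_mod_cast i3
      have eP := realG10_legs (4631 / 5000 : ℝ)
      rw [abs_of_pos (by norm_num : (0 : ℝ) < 4631 / 5000)] at eP
      unfold MI.mem at hpi mA1 mA2 mG1 mC
      refine ⟨?_, ?_, ?_⟩
      · have key : (2 * Real.pi) * sc ≤ (DA (4631 / 5000) + 2 * Real.pi) * sc := by
          linarith [hpi.2, mA1.1]
        nlinarith [le_of_mul_le_mul_right key hS]
      · have key : (DA (4632 / 5000) + 2 * Real.pi) * sc ≤ (2 * Real.pi) * sc := by
          linarith [hpi.1, mA2.2]
        nlinarith [le_of_mul_le_mul_right key hS]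
      · rw [← eP]
        have hD : DA (4631 / 5000) * sc ≤ (A1.hi : ℝ) - 2 * piI.lo := by
          have := mA1.2
          linarith [hpi.1]
        have key : (realG10 (4631 / 5000) legsA + profileAConst - 2 * Real.pi * (4631 / 5000)
            + DA (4631 / 5000) * (4632 / 5000 - 4631 / 5000)) * sc
            ≤ (-13.22912 : ℝ) * sc := by
          nlinarith [mG1.2, mC.2, hpi.1, hD]
        exact le_of_mul_le_mul_right key hS
    · simp at h
  · simp at h

/-- **The certificate**: `profileA (23/10) η ≤ −13.22912` for every `η > 0`. -/
theorem profileA_le_of_pos {η : ℝ} (hη : 0 < η) : profileA (23 / 10) η ≤ -13.22912 := by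
  obtain ⟨hD1, hD2, hP⟩ := certCheckA_sound certCheckA_eq
  have h := twoPoint (by norm_num) (by norm_num) (by norm_num) hD1 hD2 hη
  exact h.trans hP

/-- `profileA (23/10) η ≤ −13.22912` for every `η ≠ 0` (evenness). -/
theorem profileA_le {η : ℝ} (hη : η ≠ 0) : profileA (23 / 10) η ≤ -13.22912 := by
  rcases lt_or_gt_of_ne hη with h | h
  · rw [← profileA_neg_eta]
    exact profileA_le_of_pos (neg_pos.2 h)
  · exact profileA_le_of_pos h

/-! ## The certificate with slack -/

/-- On `η > 0`: `profileA0 (23/10) η − (2π − δ) η ≤ −13.22912 + 6 δ` for `0 ≤ δ ≤ 4`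
(concavity up to `η = 6`, the tail slope `PA_tail` beyond). -/
theorem certA_of_pos {δ : ℝ} (hδ0 : 0 ≤ δ) (hδ4 : δ ≤ 4) {η : ℝ} (hη : 0 < η) :
    profileA0 (23 / 10) η - (2 * π - δ) * η ≤ -13.22912 + 6 * δ := by
  have hP : profileA0 (23 / 10) η - (2 * π - δ) * η = PA η + δ * η := by
    simp only [PA, profileA, abs_of_pos hη]
    ring
  rw [hP]
  rcases le_or_gt η 6 with h6 | h6
  · have h1 : PA η ≤ -13.22912 := profileA_le_of_pos hη
    nlinarith
  · have ht := PA_tail h6.le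
    have h6v : PA 6 ≤ -13.22912 := profileA_le_of_pos (by norm_num)
    nlinarith

/-- **The `δ`-certificate**: for `0 ≤ δ ≤ 4` and every `η ≠ 0`,
`profileA0 (23/10) η − (2π − δ)|η| ≤ −13.22912 + 6 δ`. -/
theorem certA_delta {δ : ℝ} (hδ0 : 0 ≤ δ) (hδ4 : δ ≤ 4) (η : ℝ) (hη : η ≠ 0) :
    profileA0 (23 / 10) η - (2 * π - δ) * |η| ≤ -13.22912 + 6 * δ := by
  rcases lt_or_gt_of_ne hη with h | h
  · have h' : 0 < -η := by linarith
    have hc := certA_of_pos hδ0 hδ4 h'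
    rw [profileA0_neg_eta] at hc
    rw [abs_of_neg h]
    linarith
  · rw [abs_of_pos h]
    exact certA_of_pos hδ0 hδ4 h

end Summit.KontsevichZagierPeriods.Zeta5Search.Denom.RungALineCertificate

end
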